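import Summits.QuantumFields.YangMills.Theorems.F4SubCurvatureDoorFibreDichotomyShellLFHelmholtz
import Summits.QuantumFields.YangMills.Theorems.F4SubCurvatureDoorFibreDichotomyTwoPointDomination
import Mathlib
import HarnessLib

/-!
# LINE g21-B «fibre dichotomy» (⟨stmt-QuantumFields-23125⟩) — rung R-B4e `MirrorPatching` BY NAME

Crux `F4SubCurvatureDoor.RationalToGeneral` ⟨stmt-QuantumFields-23125⟩, owner file `Cruxes/RationalToGeneral/Lines/fibre_dichotomy_rungs.lean` v2
(ns `…FibreDichotomyRungs`, critic N1).  This file restates R-B4e `MirrorPatching` CHARACTER-IDENTICALLY (vocabulary `lfEval`, `IsD4Isometry`,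
`SymmetricLF` = the tree's verbatim copies in ns `…F4SubCurvatureDoorFibreDichotomyAxis`; `IsShellMeasure` = the verbatim copy of piece 1,
ns `…F4SubCurvatureDoorShellLFAnalytic`) and proves `mirrorPatching_holds : MirrorPatching`.

CONSTRUCTION.  `patch ν y := lfEval ν (swapᵢ y)` where `swapᵢ` exchanges the coordinates `0` and `i = timeIdx y`, the first non-vanishing
coordinate of `y` (a coordinate permutation, hence a `D₄`-isometry).  WELL-DEFINEDNESS / INVARIANCE: for `D₄`-isometries `R` and swaps `P, P'` with
`(P(Ry))₀ ≠ 0 ≠ (P'y)₀`, `lfEval ν (P(Ry)) = lfEval ν (P'y)` is `SymmetricLF` applied to the `D₄`-isometry `P' ≫ R ≫ P` at the point `P'y` (swaps are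
involutions).  Hence `patch ν ∘ R = patch ν`, `patch ν = lfEval ν` on `{x₀ ≠ 0}`, and near every `x ≠ 0` the patch agrees with `lfEval ν ∘ swapᵢ` for the
FIXED `i = timeIdx x`; so it is `C²` there (piece 1: `lfEval ν` is real-analytic off the mirror) and its Laplacian is that of `lfEval ν` at `swapᵢ x`
(a coordinate permutation permutes the frame `(eₖ)`), which is `s · lfEval ν (swapᵢ x) = s · patch ν x` by the Helmholtz equation of piece 2a.

HONEST LABEL: one rung (R-B4e, S–M) of the OPEN line g21-B — with R-B4a ✓p718536, R-B4b ✓p717786, R-B4c/d ✓p717372 all five typed B4 rungs are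
then tree theorems, but the stub B4 `stub_singleShellDichotomy` itself, B5, ⟨23125⟩, ⟨23035⟩, R2d and the Yang–Mills mass gap remain OPEN; no summit
is proved by a line.
-/

noncomputable section

open MeasureTheory Filter Topology Set Metric
open scoped BigOperators

namespace Summit.QuantumFields.YangMills.Theorems.F4SubCurvatureDoorMirrorPatchingRegistered

open Summit.QuantumFields.YangMills.Theorems.F4SubCurvatureDoorLaplaceFourierRegistered (E4 E3 timeSpace)
open Summit.QuantumFields.YangMills.Theorems.F4SubCurvatureDoorFibreDichotomyAxis (spacePart lfEval IsD4Isometry SymmetricLF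
  permIso permIso_apply isD4Isometry_permIso)
open Summit.QuantumFields.YangMills.Theorems.F4SubCurvatureDoorShellLFAnalytic (massSq IsShellMeasure contDiffAt_lfEval)
open Summit.QuantumFields.YangMills.Theorems.F4SubCurvatureDoorShellLFHelmholtz (helmholtz_lfEval)

/-- R-B4e «MIRROR PATCHING» (S–M; critic N1 11:55:42Z): the symmetric one-sided transform of a shell measure patches, across the mirror `x₀ = 0`, to ONE
`C²` function on `ℝ⁴ ∖ 0` that is invariant under every `D₄`-isometry and solves the Helmholtz equation `ΔK̂ = s K̂` there (Laplacian written as the sum of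
second derivatives along the coordinate axes, as in `ShellSeparationRungs.LaplacianMultiplier`).  Proof sketch: define `K̂ y := lfEval ν (R y)` for any
`D₄`-isometry `R` with `(R y)₀ ≠ 0` (every `y ≠ 0` has one: a signed coordinate permutation); independence of `R` is `SymmetricLF` + the group law;
`C²` and Helmholtz hold on `{x₀ ≠ 0}` by dominated differentiation of the shell integral (`E² = |q⃗|² + s` ν-a.e.) and transport by isometries. -/
def MirrorPatching : Prop :=
  ∀ (ν : Measure (ℝ × E3)) (s : ℝ), IsShellMeasure ν s → SymmetricLF ν →
    ∃ Kp : E4 → ℝ,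
      (∀ x : E4, x ≠ 0 → ContDiffAt ℝ 2 Kp x) ∧
      (∀ R : E4 ≃ₗᵢ[ℝ] E4, IsD4Isometry R → ∀ x : E4, Kp (R x) = Kp x) ∧
      (∀ x : E4, x 0 ≠ 0 → Kp x = lfEval ν x) ∧
      (∀ x : E4, x ≠ 0 →
        (∑ i : Fin 4, iteratedFDeriv ℝ 2 Kp x (fun _ => EuclideanSpace.single i (1 : ℝ))) = s * Kp x)

/-! ## The patch -/

/-- Index of the first non-vanishing coordinate (`3` if the first three vanish). -/
def timeIdx (y : E4) : Fin 4 :=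
  if y 0 ≠ 0 then 0 else if y 1 ≠ 0 then 1 else if y 2 ≠ 0 then 2 else 3

/-- The coordinate swap `x₀ ↔ xᵢ`, a `D₄`-isometry. -/
def swapIso (i : Fin 4) : E4 ≃ₗᵢ[ℝ] E4 := permIso (Equiv.swap 0 i)

/-- THE PATCHED KERNEL: `lfEval ν` read after swapping the first non-vanishing coordinate into the time slot. -/
def patch (ν : Measure (ℝ × E3)) (y : E4) : ℝ := lfEval ν (swapIso (timeIdx y) y)

/-- The swap moves the `i`-th coordinate to the time slot. -/
theorem swapIso_apply_zero (i : Fin 4) (y : E4) : (swapIso i y) 0 = y i := by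
  rw [swapIso, permIso_apply, Equiv.symm_swap, Equiv.swap_apply_left]

/-- Swaps are involutions. -/
theorem swapIso_swapIso (i : Fin 4) (y : E4) : swapIso i (swapIso i y) = y := by
  ext k
  rw [swapIso, permIso_apply, permIso_apply, Equiv.symm_swap, Equiv.swap_apply_self]

/-- The trivial swap is the identity. -/
theorem swapIso_zero_apply (y : E4) : swapIso 0 y = y := by
  ext k
  rw [swapIso, permIso_apply, Equiv.swap_self]
  rfl

/-- Swaps preserve `D₄`. -/
theorem isD4Isometry_swapIso (i : Fin 4) : IsD4Isometry (swapIso i) :=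
  isD4Isometry_permIso _

/-- The identity preserves `D₄`. -/
theorem isD4Isometry_refl : IsD4Isometry (LinearIsometryEquiv.refl ℝ E4) := fun z hz => ⟨z, hz, rfl⟩

/-- A swap permutes the coordinate frame. -/
theorem swapIso_single (i k : Fin 4) :
    swapIso i (EuclideanSpace.single k (1 : ℝ)) = EuclideanSpace.single (Equiv.swap 0 i k) (1 : ℝ) := by
  ext m
  rw [swapIso, permIso_apply, Equiv.symm_swap]
  by_cases hm : m = Equiv.swap 0 i k
  · subst hm
    simp [Equiv.swap_apply_self]
  · have hm' : Equiv.swap 0 i m ≠ k := fun h => hm (by rw [← h, Equiv.swap_apply_self])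
    simp [hm, hm']

/-- A non-zero point has a non-zero coordinate at `timeIdx`. -/
theorem apply_timeIdx_ne_zero (y : E4) (hy : y ≠ 0) : y (timeIdx y) ≠ 0 := by
  unfold timeIdx
  by_cases h0 : y 0 ≠ 0
  · rw [if_pos h0]; exact h0
  by_cases h1 : y 1 ≠ 0
  · rw [if_neg h0, if_pos h1]; exact h1
  by_cases h2 : y 2 ≠ 0
  · rw [if_neg h0, if_neg h1, if_pos h2]; exact h2
  rw [if_neg h0, if_neg h1, if_neg h2]
  intro h3
  apply hy
  have h0' : y 0 = 0 := not_not.1 h0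
  have h1' : y 1 = 0 := not_not.1 h1
  have h2' : y 2 = 0 := not_not.1 h2
  ext k
  fin_cases k
  · exact h0'
  · exact h1'
  · exact h2'
  · exact h3

/-- Off the mirror the index is `0`. -/
theorem timeIdx_of_ne {y : E4} (h : y 0 ≠ 0) : timeIdx y = 0 := by
  simp [timeIdx, h]

variable {ν : Measure (ℝ × E3)} {s : ℝ}

/-- Off the mirror the patch is `lfEval`. -/
theorem patch_of_ne {y : E4} (h : y 0 ≠ 0) : patch ν y = lfEval ν y := by
  rw [patch, timeIdx_of_ne h, swapIso_zero_apply]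

/-- WELL-DEFINEDNESS / INVARIANCE: two swapped readings of `D₄`-related points with non-zero times agree (`SymmetricLF` for `P' ≫ R ≫ P`). -/
theorem lfEval_swap_eq (hS : SymmetricLF ν) {R : E4 ≃ₗᵢ[ℝ] E4} (hR : IsD4Isometry R) (i i' : Fin 4) (y w : E4) (hw : w = R y)
    (h1 : (swapIso i w) 0 ≠ 0) (h2 : (swapIso i' y) 0 ≠ 0) : lfEval ν (swapIso i w) = lfEval ν (swapIso i' y) := by
  set u : E4 := swapIso i' y with hu
  have hy : swapIso i' u = y := by rw [hu, swapIso_swapIso]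
  have hQ : IsD4Isometry (((swapIso i').trans R).trans (swapIso i)) :=
    ((isD4Isometry_swapIso i').trans hR).trans (isD4Isometry_swapIso i)
  have hQu : (((swapIso i').trans R).trans (swapIso i)) u = swapIso i w := by
    simp only [LinearIsometryEquiv.trans_apply, hy, hw]
  have := hS _ hQ u h2 (by rw [hQu]; exact h1)
  rw [hQu] at this
  exact this

/-- `D₄`-INVARIANCE of the patch. -/
theorem patch_isometry (hS : SymmetricLF ν) {R : E4 ≃ₗᵢ[ℝ] E4} (hR : IsD4Isometry R) (x : E4) : patch ν (R x) = patch ν x := by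
  by_cases hx : x = 0
  · subst hx
    rw [map_zero]
  · have hRx : R x ≠ 0 := fun h => hx (by
      have := R.norm_map x
      rw [h, norm_zero] at this
      exact norm_eq_zero.1 this.symm)
    unfold patch
    exact lfEval_swap_eq hS hR (timeIdx (R x)) (timeIdx x) x (R x) rfl
      (by rw [swapIso_apply_zero]; exact apply_timeIdx_ne_zero _ hRx)
      (by rw [swapIso_apply_zero]; exact apply_timeIdx_ne_zero _ hx)

/-- LOCAL FORM: near `x ≠ 0` the patch is `lfEval ν ∘ swapᵢ` for the fixed `i = timeIdx x`. -/
theorem patch_eventuallyEq (hS : SymmetricLF ν) {x : E4} (hx : x ≠ 0) :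
    patch ν =ᶠ[𝓝 x] fun y => lfEval ν (swapIso (timeIdx x) y) := by
  have hxi := apply_timeIdx_ne_zero x hx
  have hopen : IsOpen {y : E4 | y (timeIdx x) ≠ 0} := isOpen_ne_fun (by fun_prop) continuous_const
  filter_upwards [hopen.mem_nhds hxi] with y hy
  have hy0 : y ≠ 0 := fun h => hy (by rw [h]; rfl)
  unfold patch
  exact lfEval_swap_eq hS isD4Isometry_refl (timeIdx y) (timeIdx x) y y rfl
    (by rw [swapIso_apply_zero]; exact apply_timeIdx_ne_zero _ hy0) (by rw [swapIso_apply_zero]; exact hy)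

/-- `C²` of the patch off the origin. -/
theorem contDiffAt_patch (h : IsShellMeasure ν s) (hS : SymmetricLF ν) {x : E4} (hx : x ≠ 0) : ContDiffAt ℝ 2 (patch ν) x := by
  have hxi := apply_timeIdx_ne_zero x hx
  have hP : ContDiff ℝ 2 (fun y : E4 => swapIso (timeIdx x) y) := (swapIso (timeIdx x)).toContinuousLinearEquiv.contDiff
  have hf : ContDiffAt ℝ 2 (lfEval ν) (swapIso (timeIdx x) x) :=
    contDiffAt_lfEval h (by rw [swapIso_apply_zero]; exact hxi)
  exact (hf.comp x hP.contDiffAt).congr_of_eventuallyEq (patch_eventuallyEq hS hx)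

/-- The Laplacian of `f ∘ swapᵢ` at `x` is the Laplacian of `f` at `swapᵢ x`. -/
theorem laplacian_comp_swapIso (f : E4 → ℝ) (i : Fin 4) (x : E4) :
    (∑ k : Fin 4, iteratedFDeriv ℝ 2 (fun y => f (swapIso i y)) x (fun _ => EuclideanSpace.single k (1 : ℝ)))
      = ∑ k : Fin 4, iteratedFDeriv ℝ 2 f (swapIso i x) (fun _ => EuclideanSpace.single k (1 : ℝ)) := by
  have hcomp := (swapIso i).toContinuousLinearEquiv.iteratedFDerivWithin_comp_right f uniqueDiffOn_univ (x := x)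
    (Set.mem_univ _) 2
  rw [Set.preimage_univ, iteratedFDerivWithin_univ, iteratedFDerivWithin_univ] at hcomp
  have happ : ∀ k : Fin 4, iteratedFDeriv ℝ 2 (fun y => f (swapIso i y)) x (fun _ => EuclideanSpace.single k (1 : ℝ))
      = iteratedFDeriv ℝ 2 f (swapIso i x) (fun _ => EuclideanSpace.single (Equiv.swap 0 i k) (1 : ℝ)) := by
    intro k
    have e : (fun y => f (swapIso i y)) = f ∘ ⇑((swapIso i).toContinuousLinearEquiv) := rfl
    rw [e, hcomp, ContinuousMultilinearMap.compContinuousLinearMap_apply]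
    congr 1
    funext j
    exact swapIso_single i k
  simp_rw [happ]
  exact Equiv.sum_comp (Equiv.swap 0 i) (fun k => iteratedFDeriv ℝ 2 f (swapIso i x) (fun _ => EuclideanSpace.single k (1 : ℝ)))

/-! ## The rung -/

/-- **RUNG R-B4e (by name): `MirrorPatching`.** -/
theorem mirrorPatching_holds : MirrorPatching := by
  intro ν s h hS
  refine ⟨patch ν, fun x hx => contDiffAt_patch h hS hx, fun R hR x => patch_isometry hS hR x, fun x hx => patch_of_ne hx,
    fun x hx => ?_⟩
  have hxi := apply_timeIdx_ne_zero x hx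
  have e1 : iteratedFDeriv ℝ 2 (patch ν) x = iteratedFDeriv ℝ 2 (fun y => lfEval ν (swapIso (timeIdx x) y)) x :=
    ((patch_eventuallyEq hS hx).iteratedFDeriv ℝ 2).eq_of_nhds
  simp_rw [e1]
  rw [laplacian_comp_swapIso, helmholtz_lfEval h (by rw [swapIso_apply_zero]; exact hxi)]
  rfl

end Summit.QuantumFields.YangMills.Theorems.F4SubCurvatureDoorMirrorPatchingRegistered

end
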